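import Mathlib
import Summits.MatrixMultiplication.MatrixMultiplication.Theorems.SubgroupIdentityDesigns.Negative.LevelOneSpan
import Summits.MatrixMultiplication.MatrixMultiplication.Theorems.SubgroupIdentityDesigns.Negative.LineRows

/-!
# A design puts every delta of `H₁H₃` into the span of the line rows on `S` (negative-side linking corollary for the
crux `SubgroupIdentityDesigns`, stmt-MatrixMultiplication-14079; cell B2b-5, gen 7 — report
`run/shared/lean/b2b/levelgraded-cu/ORACLE-g7.md` §G7-1, filters FR / FL)

`LevelOneSpan.single_mem_restrict_span_of_design` + `LineRows.fibreRow_mem_span_lineRows`: if `(H₁,H₂,H₃)` carries a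
level-one identity design then for all `a₀ ∈ H₁`, `g₀ ∈ H₃` the delta function of `a₀g₀` on `S = H₁H₂H₃` lies in the
span of the line rows `s ↦ [s u_l = w]`, `w ≠ 0`, restricted to `S` (`single_mem_span_lineRows_of_design`).  With
`T = H₁H₃` this is exactly the hypothesis of `RankSplit.finrank_eq_card_add_finrank_restrict` for the row space of the
census matrix `M_S` ((p+1)(p²-1) = 1440 rows at p = 11), and `LeftKernelBound.finrank_span_add_le_card` bounds that
row space by the certificate's relations: the Lean side of the two-rank FAIL criterion is complete up to
`rank_GF(2) ≤ rank_ℚ`.  Sorry-free.  VALUE = soundness lemma for a certificate format, NOT summit progress.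
-/

set_option linter.dupNamespace false

noncomputable section

open scoped BigOperators Classical
open Matrix
open Summit.MatrixMultiplication.MatrixMultiplication.Theorems.LieRankDesigns.Negative (GLm Mat)

namespace Summit.MatrixMultiplication.MatrixMultiplication.Theorems.SubgroupIdentityDesigns.Negative

namespace LineRows

variable {p : ℕ} [Fact p.Prime]

/-- **DESIGNS PUT THE DELTAS OF `H₁H₃` INTO THE SPAN OF THE LINE ROWS ON `S`.** -/
theorem single_mem_span_lineRows_of_design {L : Type*} [Fintype L] (u : L → (Fin 2 → ZMod p))
    (hu : ∀ a : Fin 2 → ZMod p, a ≠ 0 → ∃ l, ∃ c : ZMod p, c ≠ 0 ∧ a = c • u l)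
    {H₁ H₂ H₃ : Subgroup (GLm p 2)} (c : Mat p 2 → ℂ)
    (hc : ∀ M : Mat p 2, 1 < M.rank → c M = 0) (h1 : fourierMat c 1 = 1)
    (h0 : ∀ a ∈ H₁, ∀ b ∈ H₂, ∀ g ∈ H₃, a * b * g ≠ 1 → fourierMat c ((a * b * g : GLm p 2) : Mat p 2) = 0)
    {a₀ g₀ : GLm p 2} (ha₀ : a₀ ∈ H₁) (hg₀ : g₀ ∈ H₃) :
    let S : Set (CMat p 2) := {s | ∃ a ∈ H₁, ∃ b ∈ H₂, ∃ g ∈ H₃, s = ((a * b * g : GLm p 2) : Mat p 2)}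
    (fun s : S => if (s : CMat p 2) = ((a₀ * g₀ : GLm p 2) : Mat p 2) then (1 : ℂ) else 0) ∈ Submodule.span ℂ
      (Set.range fun lw : L × {w : Fin 2 → ZMod p // w ≠ 0} =>
        fun s : S => if (s : CMat p 2).mulVec (u lw.1) = lw.2.1 then (1 : ℂ) else 0) := by
  intro S
  have hS : ∀ s ∈ S, IsUnit (s : CMat p 2).det := by
    rintro s ⟨a, -, b, -, g, -, rfl⟩
    exact Matrix.isUnits_det_units _
  obtain ⟨F, hF, hFS⟩ := LevelOneSpan.single_mem_restrict_span_of_design c hc h1 h0 ha₀ hg₀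
  -- the delta on S is the restriction of F
  have hdelta : (fun s : S => if (s : CMat p 2) = ((a₀ * g₀ : GLm p 2) : Mat p 2) then (1 : ℂ) else 0) =
      LinearMap.funLeft ℂ ℂ ((↑) : S → CMat p 2) F := by
    funext s
    obtain ⟨a, ha, b, hb, g, hg, hs⟩ := s.2
    rw [LinearMap.funLeft_apply]
    simp only [hs]
    rw [hFS a ha b hb g hg]
    by_cases h : a * b * g = a₀ * g₀
    · rw [if_pos h, if_pos (by rw [h])]
    · rw [if_neg h, if_neg (fun h' => h (Units.val_injective h'))]
  rw [hdelta]
  -- the restriction of the big span lands in the span of the line rows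
  have hmap : (Submodule.span ℂ (Set.range fun aw : (Fin 2 → ZMod p) × (Fin 2 → ZMod p) =>
      fun s : CMat p 2 => if s.mulVec aw.1 = aw.2 then (1 : ℂ) else 0)).map
        (LinearMap.funLeft ℂ ℂ ((↑) : S → CMat p 2)) ≤
      Submodule.span ℂ (Set.range fun lw : L × {w : Fin 2 → ZMod p // w ≠ 0} =>
        fun s : S => if (s : CMat p 2).mulVec (u lw.1) = lw.2.1 then (1 : ℂ) else 0) := by
    rw [Submodule.map_span, Submodule.span_le]
    rintro _ ⟨_, ⟨aw, rfl⟩, rfl⟩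
    have : LinearMap.funLeft ℂ ℂ ((↑) : S → CMat p 2)
        (fun s : CMat p 2 => if s.mulVec aw.1 = aw.2 then (1 : ℂ) else 0) =
        fun s : S => if (s : CMat p 2).mulVec aw.1 = aw.2 then (1 : ℂ) else 0 := by
      funext s; rfl
    rw [SetLike.mem_coe, this]
    exact fibreRow_mem_span_lineRows u hu S hS aw.1 aw.2
  exact hmap ⟨F, hF, rfl⟩

end LineRows

end Summit.MatrixMultiplication.MatrixMultiplication.Theorems.SubgroupIdentityDesigns.Negative
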